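import Literature.NumberTheory.EllipticCurves.SingularModuliCubeSquareAwayFromSix
import Literature.NumberTheory.ModularForms.LevelTwoThetaForms
import HarnessLib

/-!
# `(j(τ_{d_K}))` is a cube away from `2` — the primes above `3` included — for every imaginary
# quadratic field, through the level-`2` Hauptmodul `s = Δ(τ)/Δ(2τ)` (Weber, *Lehrbuch* III §72;
# Cox, *Primes of the form x² + ny²*, §12)

Topic `NumberTheory/EllipticCurves` (complex multiplication).  Definitions with bodies (the function
`s = Δ(τ)/Δ(2τ) ∈ K_4` and its values) and theorems, all proved, no named fact.  Complement of
`SingularModuliCubeSquareAwayFromSix.lean` (`3 ∣ v_𝔓(j₁)` at the primes `𝔓 ∌ 3`): here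
**`3 ∣ v_𝔓(j₁)` at every prime `𝔓 ∌ 2` of `𝓞_{H_K}`**, `j₁ ∈ 𝓞_{H_K}` over `j(τ_{d_K})`
(`three_dvd_count_span_formJ_of_two_not_mem`), which covers the primes above `3`.

The mechanism is the classical parametrisation of `X₀(2)` by `s(τ) = Δ(τ)/Δ(2τ) = (η(τ)/η(2τ))²⁴`:
**`j(2τ)·s = (s + 16)³` and `j(τ)·s² = (s + 256)³`** (`kleinJ_twoMul_mul_deltaQuot`,
`kleinJ_mul_deltaQuot_sq`), proved POINTWISE on `ℍ` from the tree's theta expressions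
`E₄ = ½(U²+V²+W²)`, `Δ = (UVW)²/256`, Jacobi's `U = V + W` and Landen's duplication
`U(2τ) = (θ₃²+θ₄²)²/4`, `V(2τ) = (θ₃²−θ₄²)²/4`, `W(2τ) = θ₃²θ₄²` (`JacobiThetaGammaTwo.lean`,
`LevelTwoThetaForms.lean`).  At a CM point `τ_Q` of level `4` whose `2τ`-slot (resp. `τ`-slot) is
the maximal order (`Q = (4, 2b, c)`, `c` odd, resp. a Heegner form of level `4` when
`d_K ≡ 1 (mod 8)`), `s₀ = s(τ_Q)` lies in `H_K(j(τ_Q))` (transport of the rational element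
`s ∈ ℚ(X₀(4))`, `deltaQuotValue_mem_adjoin`), is an algebraic integer dividing `2²⁴` (it is a root of
the monic cubic over `ℤ[j]`), and `H_K(j(τ_Q))/H_K` is unramified outside `2`
(`isUnramifiedIn_adjoin_formJ_conductor`, conductor `2`); so at a prime `𝔓 ∌ 2`,
`v_𝔓(j₁) = 3·v_𝔔(s₀ + 16) − v_𝔔(s₀) = 3·v_𝔔(s₀ + 16)`.

## References

* D. A. Cox, *Primes of the form x² + ny²*, 2nd ed. (2013), §12.A–B (Weber functions, the orders of
  conductor `2`), §11.B (11.15) (`X₀(2)`). [Cox2013]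
* G. Shimura, *Introduction to the arithmetic theory of automorphic functions* (1971), §6.8 (values of
  rational modular functions at CM points). [ShimuraIATAF1971]
* H. Cohn, A. Kumar, S. D. Miller, D. Radchenko, M. Viazovska, Ann. of Math. 196 (2022), §2.1.2
  (`E₄`, `Δ` through `U, V, W`). [CohnEtAl2019]
* J. Neukirch, *Algebraic Number Theory* (1999), Ch. I §8. [NeukirchANT1999]
-/

noncomputable section

open Complex Polynomial IntermediateField NumberField IsDedekindDomain
open UpperHalfPlane hiding I
open scoped MatrixGroups Modular Cardinal ModularForm

namespace Literature.NumberTheory.EllipticCurves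

universe u v

open ModularForms CongruenceSubgroup
open Literature.NumberTheory.NumberFields
open Literature.NumberTheory.ModularForms
open Literature.NumberTheory.EllipticCurves.JacobiThetaNull
open Literature.FieldTheory.AlgClosed
open Literature.NumberTheory.QuadraticFields.BinaryQuadraticForm
open Literature.NumberTheory.QuadraticFields.Quadratic (discr_emod_four)

/-! ### The level-`2` parametrisation: `j(2τ)·s = (s + 16)³`, `j(τ)·s² = (s + 256)³` -/

section LevelTwo

/-- `tpD 2 • τ = 2τ` (`twoMul`). [folklore] -/
theorem tpD_two_smul_eq_twoMul (τ : ℍ) : tpD 2 • τ = twoMul τ :=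
  UpperHalfPlane.ext (by rw [coe_tpD_two_smul, coe_twoMul])

/-- The rational identity behind `j(2τ)·s = (s + 16)³`, in the squares `a = θ₃²`, `b = θ₄²`.
[folklore] -/
theorem levelTwo_identity_two {a b : ℂ} (ha : a ≠ 0) (hb : b ≠ 0) (hab : a ^ 2 - b ^ 2 ≠ 0) :
    (16 * (a ^ 4 + 14 * a ^ 2 * b ^ 2 + b ^ 4) ^ 3 / ((a ^ 2 - b ^ 2) ^ 4 * a ^ 2 * b ^ 2)) *
        (256 * a ^ 2 * b ^ 2 / (a ^ 2 - b ^ 2) ^ 2) =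
      (256 * a ^ 2 * b ^ 2 / (a ^ 2 - b ^ 2) ^ 2 + 16) ^ 3 := by
  field_simp
  ring

/-- The rational identity behind `j(τ)·s² = (s + 256)³`. [folklore] -/
theorem levelTwo_identity_one {a b : ℂ} (ha : a ≠ 0) (hb : b ≠ 0) (hab : a ^ 2 - b ^ 2 ≠ 0) :
    (256 * (a ^ 4 - a ^ 2 * b ^ 2 + b ^ 4) ^ 3 / (a ^ 4 * b ^ 4 * (a ^ 2 - b ^ 2) ^ 2)) *
        (256 * a ^ 2 * b ^ 2 / (a ^ 2 - b ^ 2) ^ 2) ^ 2 =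
      (256 * a ^ 2 * b ^ 2 / (a ^ 2 - b ^ 2) ^ 2 + 256) ^ 3 := by
  field_simp
  ring

variable (τ : ℍ)

/-- `θ₃(τ)² ≠ 0`, `θ₄(τ)² ≠ 0`, `θ₃⁴ − θ₄⁴ = θ₂⁴ ≠ 0` on `ℍ`. [folklore] -/
theorem theta_sq_ne_zero :
    theta3 τ ^ 2 ≠ 0 ∧ theta4 τ ^ 2 ≠ 0 ∧ (theta3 τ ^ 2) ^ 2 - (theta4 τ ^ 2) ^ 2 ≠ 0 := by
  have hU := thetaU_ne_zero τ
  have hW := thetaW_ne_zero τ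
  have hV := thetaV_ne_zero τ
  rw [thetaU_apply] at hU
  rw [thetaW_apply] at hW
  refine ⟨fun h ↦ hU (by rw [show (4 : ℕ) = 2 * 2 from rfl, pow_mul, h, zero_pow two_ne_zero]),
    fun h ↦ hW (by rw [show (4 : ℕ) = 2 * 2 from rfl, pow_mul, h, zero_pow two_ne_zero]), fun h ↦ hV ?_⟩
  have hJ := thetaU_apply_eq τ
  rw [thetaU_apply, thetaW_apply] at hJ
  have : thetaV τ = (theta3 τ ^ 2) ^ 2 - (theta4 τ ^ 2) ^ 2 := by
    rw [← pow_mul, ← pow_mul]; linear_combination -hJ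
  rw [this, h]

/-- `V = θ₃⁴ − θ₄⁴` (Jacobi). [folklore] -/
theorem thetaV_eq_sq_sub_sq : thetaV τ = (theta3 τ ^ 2) ^ 2 - (theta4 τ ^ 2) ^ 2 := by
  have hJ := thetaU_apply_eq τ
  rw [thetaU_apply, thetaW_apply] at hJ
  rw [← pow_mul, ← pow_mul]; linear_combination -hJ

/-- **`s(τ) = Δ(τ)/Δ(2τ) = 256 θ₃⁴θ₄⁴/θ₂⁸`** in the theta coordinates. [cite: CohnEtAl2019, §2.1.2] -/
theorem discriminant_div_twoMul_eq :
    ModularForm.discriminant τ / ModularForm.discriminant (twoMul τ) =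
      256 * (theta3 τ ^ 2) ^ 2 * (theta4 τ ^ 2) ^ 2 / ((theta3 τ ^ 2) ^ 2 - (theta4 τ ^ 2) ^ 2) ^ 2 := by
  obtain ⟨ha, hb, hab⟩ := theta_sq_ne_zero τ
  rw [discriminant_eq_theta, discriminant_eq_theta, thetaU_twoMul, thetaV_twoMul, thetaW_twoMul,
    thetaU_apply, thetaW_apply, thetaV_eq_sq_sub_sq, show (4 : ℕ) = 2 * 2 from rfl, pow_mul, pow_mul]
  generalize theta3 (τ : ℂ) ^ 2 = A at ha hab ⊢
  generalize theta4 (τ : ℂ) ^ 2 = B at hb hab ⊢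
  have h2 : A + B ≠ 0 := fun h ↦ hab (by
    rw [show A ^ 2 - B ^ 2 = (A + B) * (A - B) by ring, h, zero_mul])
  have h3 : A - B ≠ 0 := fun h ↦ hab (by
    rw [show A ^ 2 - B ^ 2 = (A + B) * (A - B) by ring, h, mul_zero])
  field_simp
  ring

/-- **`j(2τ) = 16(θ₃⁸ + 14θ₃⁴θ₄⁴ + θ₄⁸)³/(θ₂¹⁶ θ₃⁴ θ₄⁴)`** in the theta coordinates. [cite: CohnEtAl2019, §2.1.2] -/
theorem kleinJ_twoMul_eq :
    kleinJ (twoMul τ) = 16 * ((theta3 τ ^ 2) ^ 4 + 14 * (theta3 τ ^ 2) ^ 2 * (theta4 τ ^ 2) ^ 2 +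
      (theta4 τ ^ 2) ^ 4) ^ 3 / (((theta3 τ ^ 2) ^ 2 - (theta4 τ ^ 2) ^ 2) ^ 4 *
        (theta3 τ ^ 2) ^ 2 * (theta4 τ ^ 2) ^ 2) := by
  obtain ⟨ha, hb, hab⟩ := theta_sq_ne_zero τ
  rw [kleinJ, E₄_eq_theta, discriminant_eq_theta, thetaU_twoMul, thetaV_twoMul, thetaW_twoMul]
  generalize theta3 (τ : ℂ) ^ 2 = A at ha hab ⊢
  generalize theta4 (τ : ℂ) ^ 2 = B at hb hab ⊢
  have h2 : A + B ≠ 0 := fun h ↦ hab (by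
    rw [show A ^ 2 - B ^ 2 = (A + B) * (A - B) by ring, h, zero_mul])
  have h3 : A - B ≠ 0 := fun h ↦ hab (by
    rw [show A ^ 2 - B ^ 2 = (A + B) * (A - B) by ring, h, mul_zero])
  field_simp
  ring

/-- **`j(τ) = 256(θ₃⁸ − θ₃⁴θ₄⁴ + θ₄⁸)³/(θ₃⁸ θ₄⁸ θ₂⁸)`** in the theta coordinates. [cite: CohnEtAl2019, §2.1.2] -/
theorem kleinJ_eq_theta :
    kleinJ τ = 256 * ((theta3 τ ^ 2) ^ 4 - (theta3 τ ^ 2) ^ 2 * (theta4 τ ^ 2) ^ 2 +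
      (theta4 τ ^ 2) ^ 4) ^ 3 / ((theta3 τ ^ 2) ^ 4 * (theta4 τ ^ 2) ^ 4 *
        ((theta3 τ ^ 2) ^ 2 - (theta4 τ ^ 2) ^ 2) ^ 2) := by
  obtain ⟨ha, hb, hab⟩ := theta_sq_ne_zero τ
  rw [kleinJ, E₄_eq_theta, discriminant_eq_theta, thetaU_apply, thetaW_apply, thetaV_eq_sq_sub_sq,
    show (4 : ℕ) = 2 * 2 from rfl, pow_mul, pow_mul]
  generalize theta3 (τ : ℂ) ^ 2 = A at ha hab ⊢
  generalize theta4 (τ : ℂ) ^ 2 = B at hb hab ⊢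
  field_simp
  ring

/-- **`j(2τ) · s(τ) = (s(τ) + 16)³`**, `s = Δ(τ)/Δ(2τ)` — the parametrisation of `X₀(2)` by its
Hauptmodul (Weber; Cox (11.15) for `Φ₂`). [cite: Cox2013, §11.B (11.15)] -/
theorem kleinJ_twoMul_mul_deltaQuot :
    kleinJ (twoMul τ) * (ModularForm.discriminant τ / ModularForm.discriminant (twoMul τ)) =
      (ModularForm.discriminant τ / ModularForm.discriminant (twoMul τ) + 16) ^ 3 := by
  obtain ⟨ha, hb, hab⟩ := theta_sq_ne_zero τ
  rw [kleinJ_twoMul_eq, discriminant_div_twoMul_eq]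
  exact levelTwo_identity_two ha hb hab

/-- **`j(τ) · s(τ)² = (s(τ) + 256)³`**, `s = Δ(τ)/Δ(2τ)`. [cite: Cox2013, §11.B (11.15)] -/
theorem kleinJ_mul_deltaQuot_sq :
    kleinJ τ * (ModularForm.discriminant τ / ModularForm.discriminant (twoMul τ)) ^ 2 =
      (ModularForm.discriminant τ / ModularForm.discriminant (twoMul τ) + 256) ^ 3 := by
  obtain ⟨ha, hb, hab⟩ := theta_sq_ne_zero τ
  rw [kleinJ_eq_theta, discriminant_div_twoMul_eq]
  exact levelTwo_identity_one ha hb hab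

end LevelTwo

/-! ### The element `s = Δ(τ)/Δ(2τ)` of `K_4 = ℂ(X₀(4))` and its values -/

section Function

/-- **The value `s(τ) = Δ(τ)/Δ(2τ)`** of the level-`2` Hauptmodul (`= (η(τ)/η(2τ))²⁴`). [cite: Cox2013, §12.B] -/
def deltaQuotValue (τ : ℍ) : ℂ :=
  ModularForm.discriminant τ / ModularForm.discriminant (tpD 2 • τ)

/-- `deltaQuotValue τ = Δ(τ)/Δ(2τ)` with `2τ = twoMul τ`. [folklore] -/
theorem deltaQuotValue_eq (τ : ℍ) :
    deltaQuotValue τ = ModularForm.discriminant τ / ModularForm.discriminant (twoMul τ) := by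
  rw [deltaQuotValue, tpD_two_smul_eq_twoMul]

/-- `s(τ) ≠ 0`. [folklore] -/
theorem deltaQuotValue_ne_zero (τ : ℍ) : deltaQuotValue τ ≠ 0 :=
  div_ne_zero (ModularForm.discriminant_ne_zero _) (ModularForm.discriminant_ne_zero _)

/-- `j(2τ)·s(τ) = (s(τ) + 16)³`. [cite: Cox2013, §11.B (11.15)] -/
theorem kleinJ_tpD_two_mul_deltaQuotValue (τ : ℍ) :
    kleinJ (tpD 2 • τ) * deltaQuotValue τ = (deltaQuotValue τ + 16) ^ 3 := by
  rw [deltaQuotValue_eq, tpD_two_smul_eq_twoMul]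
  exact kleinJ_twoMul_mul_deltaQuot τ

/-- `j(τ)·s(τ)² = (s(τ) + 256)³`. [cite: Cox2013, §11.B (11.15)] -/
theorem kleinJ_mul_deltaQuotValue_sq (τ : ℍ) :
    kleinJ τ * deltaQuotValue τ ^ 2 = (deltaQuotValue τ + 256) ^ 3 := by
  rw [deltaQuotValue_eq]
  exact kleinJ_mul_deltaQuot_sq τ

/-- **`s = Δ(τ)/Δ(2τ)` as an element of `K_4 = ℂ(X₀(4))`**: the class of `Δ|_{Γ₀(4)} / Δ(2τ)`. [cite: Cox2013, §12.B] -/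
def deltaQuotFn : modularFunctionField 4 :=
  mkFn (deltaN 4) deltaTwoFour deltaTwoFour_ne_zero

/-- **The value of `s ∈ K_4` at `τ` is `Δ(τ)/Δ(2τ)`.** [folklore] -/
theorem pointValuation_deltaQuotFn_sub_lt_one (τ : ℍ) :
    pointValuation (N := 4) τ (deltaQuotFn - algebraMap ℂ (modularFunctionField 4) (deltaQuotValue τ)) < 1 := by
  apply pointValuation_mkFn_sub_lt_one_of_orderAt_lt
  set c : ℂ := deltaQuotValue τ with hc
  set G : ModularForm (Gamma0 4) 12 := deltaN 4 - c • deltaTwoFour with hG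
  by_cases hG0 : G = 0
  · exact Or.inl hG0
  · right
    have hGτ : G τ = 0 := by
      have h1 : G τ = deltaN 4 τ - c * deltaTwoFour τ := by
        simp [hG, sub_eq_add_neg]
      rw [h1, deltaTwoFour_apply, hc, deltaQuotValue,
        div_mul_cancel₀ _ (ModularForm.discriminant_ne_zero _)]
      simp [deltaN]
    rw [(orderAt_eq_zero_iff deltaTwoFour_ne_zero τ).mpr (deltaTwoFour_apply_ne_zero τ)]
    exact Nat.pos_of_ne_zero fun h0 ↦ (orderAt_eq_zero_iff hG0 τ).mp h0 hGτ

/-- **`s ∈ ℚ(X₀(4))`: the `q`-series of `s ∈ K_4` is fixed by every ring endomorphism `σ` of `ℂ`**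
(`Δ` and `Δ(2τ)` have rational `q`-expansions). [folklore] -/
theorem mapLaurent_deltaQuotFn (σ : ℂ →+* ℂ) :
    mapLaurent σ ((deltaQuotFn : modularFunctionField 4) : LaurentSeries ℂ) = deltaQuotFn := by
  change mapLaurent σ (qExpansionL 4 (deltaN 4) / qExpansionL 4 deltaTwoFour) =
    qExpansionL 4 (deltaN 4) / qExpansionL 4 deltaTwoFour
  rw [map_div₀, mapLaurent_qExpansionL_four_eq σ (isRatQExp_deltaN (N := 4) σ),
    mapLaurent_qExpansionL_four_eq σ (isRatQExp_deltaTwoFour σ)]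

end Function

/-! ### Transport: `Aut(ℂ)` fixing `√D` and `j(τ_Q)` fixes `s(τ_Q)` -/

section Transport

variable {a b c : ℤ}

/-- An automorphism of `ℂ` fixing `√D` and `x = j(τ_{Q₀}/2)`, `Q₀ = (a, b, c)` with `a, c` odd, fixes
`s(τ_{Q₀}/2)`: level-`4` transport at the CM point `τ_{(4a, 2b, c)}` (Bezout `4u + acw = 1`) and
`Aut(ℂ)`-invariance of the `q`-series of `s`. [cite: ShimuraIATAF1971, §6.8 and Thm. 6.31] -/
theorem apply_deltaQuotValue_half_eq (ha : 0 < a) (hprim : IsPrimitive (a, b, c))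
    (hD : b ^ 2 - 4 * a * c < 0) (hao : Odd a) (hco : Odd c) {σ : ℂ ≃+* ℂ}
    (hσ : σ (sqrtDisc (b ^ 2 - 4 * a * c)) = sqrtDisc (b ^ 2 - 4 * a * c))
    (hx : σ (formJ ((4 * a : ℤ), 2 * b, c)) = formJ ((4 * a : ℤ), 2 * b, c)) :
    σ (deltaQuotValue (heegnerTau ((4 * a : ℤ), 2 * b, c))) =
      deltaQuotValue (heegnerTau ((4 * a : ℤ), 2 * b, c)) := by
  obtain ⟨u, w, huw⟩ := (isCoprime_four_of_odd (hao.mul hco)).symm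
  have hc' : 4 * ((4 : ℕ) : ℤ) * (a * c) = (2 * b) ^ 2 - 4 * (b ^ 2 - 4 * a * c) := by
    push_cast; ring
  have huvw : u * ((4 : ℕ) : ℤ) + 0 * (2 * b) + w * (a * c) = 1 := by
    push_cast; linear_combination huw
  have hσ4 : σ (sqrtDisc (4 * (b ^ 2 - 4 * a * c))) = sqrtDisc (4 * (b ^ 2 - 4 * a * c)) := by
    rw [sqrtDisc_four_mul, map_mul, map_ofNat, hσ]
  have hT := levelTransport_self_of_apply_formJ_eq_bezout (N := 4) (by linarith) hc' huvw hσ4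
    (half_mem_heegnerForms ha hprim hco) (Int.ModEq.refl _) hx
  exact LevelTransport.apply_value_eq (N := 4) hT (mapLaurent_deltaQuotFn (σ : ℂ →+* ℂ))
    (pointValuation_deltaQuotFn_sub_lt_one _)

end Transport

/-! ### `s(τ_Q)` lies in `H_K(j(τ_Q))` -/

section Membership

variable {K : Type*} [Field K] [NumberField K]

/-- **`s(τ_{Q₀}/2) ∈ H_K(j(τ_{Q₀}/2))`** for `Q₀ = (a, b, c)` of discriminant `d_K` with `a, c` odd: the
fixed field of `Aut(ℂ/H_K(x))` is `H_K(x)`. [cite: ShimuraIATAF1971, §6.8 and Thm. 6.31] -/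
theorem deltaQuotValue_half_mem_adjoin (hK : IsImaginaryQuadratic K) (ι : K →+* ℂ) {a b c : ℤ}
    (ha : 0 < a) (hprim : IsPrimitive (a, b, c)) (hdisc : discr (a, b, c) = NumberField.discr K)
    (hao : Odd a) (hco : Odd c) :
    deltaQuotValue (heegnerTau ((4 * a : ℤ), 2 * b, c)) ∈
      adjoin (singularModuliField K ι) ({formJ ((4 * a : ℤ), 2 * b, c)} : Set ℂ) := by
  set H := singularModuliField K ι with hHdef
  set x := formJ ((4 * a : ℤ), 2 * b, c) with hxdef
  have hD : b ^ 2 - 4 * a * c < 0 := by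
    have := hK.discr_neg; rw [← hdisc, QuadraticFields.BinaryQuadraticForm.discr_apply] at this
    exact this
  have hrange : Set.range (algebraMap H ℂ) = (H : Set ℂ) := by
    ext z; constructor
    · rintro ⟨y, rfl⟩; exact y.2
    · intro hz; exact ⟨⟨z, hz⟩, rfl⟩
  have hcount : #((adjoin H ({x} : Set ℂ)).toSubfield) ≤ ℵ₀ := by
    rw [adjoin_toSubfield]
    refine (Subfield.cardinalMk_closure_le_max _).trans (max_le ?_ le_rfl)
    refine (Cardinal.mk_union_le _ _).trans ?_
    rw [Cardinal.add_le_aleph0]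
    exact ⟨Cardinal.mk_range_le.trans (cardinalMk_singularModuliField_le K hK ι), by simp⟩
  refine Complex.mem_subfield_of_forall_ringEquiv _ hcount fun σ hσ ↦ ?_
  have hfixH : ∀ z ∈ H, σ z = z := fun z hz ↦
    hσ z (by
      show z ∈ (adjoin H ({x} : Set ℂ)).toSubfield
      rw [adjoin_toSubfield]
      exact Subfield.subset_closure (Or.inl (hrange ▸ hz)))
  have hσD : σ (sqrtDisc (b ^ 2 - 4 * a * c)) = sqrtDisc (b ^ 2 - 4 * a * c) := by
    have h := apply_sqrtDisc_discr_eq hK ι fun k ↦ hfixH _ (apply_mem_singularModuliField ι k)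
    rwa [← hdisc, QuadraticFields.BinaryQuadraticForm.discr_apply] at h
  have hσx : σ x = x := hσ x (subset_adjoin H ({x} : Set ℂ) rfl)
  exact apply_deltaQuotValue_half_eq ha hprim hD hao hco hσD hσx

/-- An automorphism of `ℂ` fixing `√d_K` and `j(τ_Q)`, `Q` a Heegner form of level `4` and
discriminant `d_K ≡ 1 (mod 8)`, fixes `s(τ_Q)`. [cite: ShimuraIATAF1971, §6.8 and Thm. 6.31] -/
theorem apply_deltaQuotValue_heegnerTau_eq (hK : IsImaginaryQuadratic K)
    (h8 : NumberField.discr K % 8 = 1) {β : ℤ}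
    (hβD : (4 * (4 : ℕ) : ℤ) ∣ β ^ 2 - NumberField.discr K) {σ : ℂ ≃+* ℂ}
    (hσ : σ (sqrtDisc (NumberField.discr K)) = sqrtDisc (NumberField.discr K))
    {Q : ℤ × ℤ × ℤ} (hQ : Q ∈ heegnerForms 4 (NumberField.discr K))
    (hβ : Q.2.1 ≡ β [ZMOD 2 * (4 : ℕ)]) (hj : σ (formJ Q) = formJ Q) :
    σ (deltaQuotValue (heegnerTau Q)) = deltaQuotValue (heegnerTau Q) := by
  have hT := levelTransport_self_of_apply_formJ_eq hK.discr_neg (isCoprime_four_discr h8) hβD hσ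
    hQ hβ hj
  exact LevelTransport.apply_value_eq (N := 4) hT (mapLaurent_deltaQuotFn (σ : ℂ →+* ℂ))
    (pointValuation_deltaQuotFn_sub_lt_one (heegnerTau Q))

/-- **`s(τ_Q) ∈ H_K`** for a Heegner form `Q` of level `4`, `d_K ≡ 1 (mod 8)`. [cite: Cox2013, §12.B Thm. 12.17 (method)] -/
theorem deltaQuotValue_heegnerTau_mem_singularModuliField (hK : IsImaginaryQuadratic K)
    (h8 : NumberField.discr K % 8 = 1) (ι : K →+* ℂ) {β : ℤ}
    (hβD : (4 * (4 : ℕ) : ℤ) ∣ β ^ 2 - NumberField.discr K)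
    {Q : ℤ × ℤ × ℤ} (hQ : Q ∈ heegnerForms 4 (NumberField.discr K))
    (hβ : Q.2.1 ≡ β [ZMOD 2 * (4 : ℕ)]) :
    deltaQuotValue (heegnerTau Q) ∈ singularModuliField K ι := by
  refine Complex.mem_subfield_of_forall_ringEquiv _ (cardinalMk_singularModuliField_le K hK ι) ?_
  intro σ hσ
  have hσD : σ (sqrtDisc (NumberField.discr K)) = sqrtDisc (NumberField.discr K) :=
    apply_sqrtDisc_discr_eq hK ι fun x ↦ hσ _ (apply_mem_singularModuliField ι x)
  have hjmem : kleinJ (heegnerTau Q) ∈ singularModuliField K ι :=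
    kleinJ_heegnerTau_mem_singularModuliField hK ι hQ
  have hj : σ (formJ Q) = formJ Q := by
    rw [formJ_def, ← kleinJ_eq_periodPair_j]
    exact hσ _ hjmem
  exact apply_deltaQuotValue_heegnerTau_eq hK h8 hβD hσD hQ hβ hj

end Membership

/-! ### Integrality of a root of a monic cubic with integral coefficients -/

section Integral

/-- A root of `X³ + c₂X² + c₁X + c₀` with `c₀, c₁, c₂` integral over `ℤ` is integral over `ℤ`
(integrality is transitive). [folklore] -/
theorem isIntegral_of_cubic_eq_zero {x c₀ c₁ c₂ : ℂ} (h₀ : IsIntegral ℤ c₀) (h₁ : IsIntegral ℤ c₁)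
    (h₂ : IsIntegral ℤ c₂) (h : x ^ 3 + c₂ * x ^ 2 + c₁ * x + c₀ = 0) : IsIntegral ℤ x := by
  set A : Subalgebra ℤ ℂ := Algebra.adjoin ℤ {c₀, c₁, c₂} with hA
  haveI : Algebra.IsIntegral ℤ A := Algebra.IsIntegral.adjoin (by
    rintro y (rfl | rfl | rfl)
    exacts [h₀, h₁, h₂])
  have hc₀ : c₀ ∈ A := Algebra.subset_adjoin (by simp)
  have hc₁ : c₁ ∈ A := Algebra.subset_adjoin (by simp)
  have hc₂ : c₂ ∈ A := Algebra.subset_adjoin (by simp)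
  set p : Polynomial A := X ^ 3 + C (⟨c₂, hc₂⟩ : A) * X ^ 2 + C (⟨c₁, hc₁⟩ : A) * X + C (⟨c₀, hc₀⟩ : A)
    with hp
  have hmonic : p.Monic := by
    rw [hp]
    refine Monic.add_of_left (Monic.add_of_left (Monic.add_of_left (monic_X_pow 3) ?_) ?_) ?_
    · exact (degree_C_mul_X_pow_le _ _).trans_lt (by rw [degree_X_pow]; norm_num)
    · refine (degree_C_mul_X_le _).trans_lt ?_
      rw [degree_add_eq_left_of_degree_lt, degree_X_pow]
      · norm_num
      · exact (degree_C_mul_X_pow_le _ _).trans_lt (by rw [degree_X_pow]; norm_num)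
    · refine (degree_C_le).trans_lt ?_
      rw [degree_add_eq_left_of_degree_lt, degree_add_eq_left_of_degree_lt, degree_X_pow]
      · norm_num
      · exact (degree_C_mul_X_pow_le _ _).trans_lt (by rw [degree_X_pow]; norm_num)
      · rw [degree_add_eq_left_of_degree_lt, degree_X_pow]
        · exact (degree_C_mul_X_le _).trans_lt (by norm_num)
        · exact (degree_C_mul_X_pow_le _ _).trans_lt (by rw [degree_X_pow]; norm_num)
  have hroot : aeval x p = 0 := by
    rw [hp]
    simp only [map_add, map_mul, aeval_X_pow, aeval_C, aeval_X]
    exact h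
  exact isIntegral_trans x ⟨p, hmonic, by rwa [aeval_def] at hroot⟩

end Integral

/-! ### Exponents through an unramified extension carrying `a·sᵏ = gⁿ` with `s` an `S`-unit -/

section Plumbing

variable {F : Type u} {L : Type v} [Field F] [NumberField F] [Field L] [NumberField L] [Algebra F L]

/-- **`n ∣ v(a)` when `a·sᵏ = gⁿ` in an extension unramified at `v`, `s` dividing an element of `𝓞_F`
outside `v`.**  (At a prime `w ∣ v` upstairs, `w(s) = 0` and `e(w|v) = 1`, so `v(a) = n·w(g)`.)
[cite: NeukirchANT1999, Ch. I §8 Prop. 8.2] -/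
theorem dvd_count_of_mul_pow_eq_pow_of_isUnramifiedIn {a : 𝓞 F} (ha : a ≠ 0) {s g t : 𝓞 L} {k n : ℕ}
    {c : 𝓞 F} (hg : algebraMap (𝓞 F) (𝓞 L) a * s ^ k = g ^ n) (hst : s * t = algebraMap (𝓞 F) (𝓞 L) c)
    (v : HeightOneSpectrum (𝓞 F)) (hc : c ∉ v.asIdeal) (hunr : Algebra.IsUnramifiedIn (𝓞 L) v.asIdeal) :
    n ∣ (Associates.mk v.asIdeal).count (Associates.mk (Ideal.span {a})).factors := by
  classical
  haveI := v.isMaximal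
  obtain ⟨Q, hQmax, hQover⟩ := Ideal.exists_maximal_ideal_liesOver_of_isIntegral (S := 𝓞 L) v.asIdeal
  haveI := hQmax
  haveI := hQover
  have hQ0 : Q ≠ ⊥ := Ideal.ne_bot_of_liesOver_of_ne_bot v.ne_bot Q
  set w : HeightOneSpectrum (𝓞 L) := ⟨Q, hQmax.isPrime, hQ0⟩ with hw
  haveI : w.asIdeal.LiesOver v.asIdeal := hQover
  haveI : Algebra.IsUnramifiedAt (𝓞 F) w.asIdeal := hunr Q hQmax.isPrime hQover
  have he : v.asIdeal.ramificationIdx' w.asIdeal = 1 := by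
    rw [Ideal.ramificationIdx'_eq_ramificationIdx v.asIdeal w.asIdeal v.ne_bot]
    exact Ideal.ramificationIdx_eq_one_of_isUnramifiedAt
  -- `s ∉ w`
  have hs : s ∉ w.asIdeal := by
    intro hsw
    apply hc
    have h1 : algebraMap (𝓞 F) (𝓞 L) c ∈ Q := by rw [← hst]; exact Q.mul_mem_right t hsw
    have h2 : c ∈ Q.under (𝓞 F) := Ideal.mem_comap.mpr h1
    rwa [← hQover.over] at h2
  have hsval : w.intValuation s = 1 := (IsDedekindDomain.HeightOneSpectrum.intValuation_eq_one_iff (v := w)).mpr hs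
  -- valuations
  have hval := IsDedekindDomain.HeightOneSpectrum.intValuation_liesOver v w a
  rw [he, pow_one] at hval
  have hval2 : w.intValuation (algebraMap (𝓞 F) (𝓞 L) a * s ^ k) = w.intValuation (g ^ n) := by rw [hg]
  rw [map_mul, map_pow, hsval, one_pow, mul_one, ← hval, map_pow, v.intValuation_if_neg ha] at hval2
  rcases Nat.eq_zero_or_pos n with hn | hn
  · subst hn
    rw [pow_zero, ← WithZero.exp_zero, WithZero.exp_inj, neg_eq_zero, Nat.cast_eq_zero] at hval2
    rw [hval2]
  have hg0 : g ≠ 0 := by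
    intro h0
    rw [h0, map_zero, zero_pow hn.ne'] at hval2
    exact WithZero.exp_ne_zero hval2
  rw [w.intValuation_if_neg hg0, ← WithZero.exp_nsmul, WithZero.exp_inj, nsmul_eq_mul] at hval2
  refine ⟨(Associates.mk w.asIdeal).count (Associates.mk (Ideal.span {g})).factors, ?_⟩
  have : ((Associates.mk v.asIdeal).count (Associates.mk (Ideal.span {a})).factors : ℤ) =
      n * (Associates.mk w.asIdeal).count (Associates.mk (Ideal.span {g})).factors := by linarith
  exact_mod_cast this

end Plumbing

section PlumbingSelf

variable {F : Type u} [Field F] [NumberField F]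

/-- **`n ∣ v(a)` when `a·sᵏ = gⁿ` in `𝓞_F` itself with `s ∣ c`, `c ∉ v`.** [cite: NeukirchANT1999, Ch. I §3] -/
theorem dvd_count_of_mul_pow_eq_pow_self {a s g t c : 𝓞 F} (ha : a ≠ 0) {k n : ℕ}
    (hg : a * s ^ k = g ^ n) (hst : s * t = c) (v : HeightOneSpectrum (𝓞 F)) (hc : c ∉ v.asIdeal) :
    n ∣ (Associates.mk v.asIdeal).count (Associates.mk (Ideal.span {a})).factors := by
  classical
  have hs : s ∉ v.asIdeal := fun hsv ↦ hc (by rw [← hst]; exact v.asIdeal.mul_mem_right t hsv)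
  have hsval : v.intValuation s = 1 := (IsDedekindDomain.HeightOneSpectrum.intValuation_eq_one_iff (v := v)).mpr hs
  have hval2 : v.intValuation (a * s ^ k) = v.intValuation (g ^ n) := by rw [hg]
  rw [map_mul, map_pow, hsval, one_pow, mul_one, map_pow, v.intValuation_if_neg ha] at hval2
  rcases Nat.eq_zero_or_pos n with hn | hn
  · subst hn
    rw [pow_zero, ← WithZero.exp_zero, WithZero.exp_inj, neg_eq_zero, Nat.cast_eq_zero] at hval2
    rw [hval2]
  have hg0 : g ≠ 0 := by
    intro h0
    rw [h0, map_zero, zero_pow hn.ne'] at hval2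
    exact WithZero.exp_ne_zero hval2
  rw [v.intValuation_if_neg hg0, ← WithZero.exp_nsmul, WithZero.exp_inj, nsmul_eq_mul] at hval2
  refine ⟨(Associates.mk v.asIdeal).count (Associates.mk (Ideal.span {g})).factors, ?_⟩
  have : ((Associates.mk v.asIdeal).count (Associates.mk (Ideal.span {a})).factors : ℤ) =
      n * (Associates.mk v.asIdeal).count (Associates.mk (Ideal.span {g})).factors := by linarith
  exact_mod_cast this

end PlumbingSelf

/-! ### Main theorem -/

section Main

variable {K : Type} [Field K] [NumberField K]

/-- `1728` and every natural number are integral over `ℤ` in `ℂ`. [folklore] -/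
theorem isIntegral_natCast (n : ℕ) : IsIntegral ℤ (n : ℂ) := by
  have h := isIntegral_algebraMap (R := ℤ) (A := ℂ) (x := (n : ℤ))
  simpa using h

/-- **`3 ∣ v_𝔓(j₁)` for every prime `𝔓 ∌ 2` of `𝓞_{H_K}`** (in particular for the primes above `3`),
`j₁ ∈ 𝓞_{H_K}` over `j(τ_{d_K})`, `j₁ ≠ 0`, for every imaginary quadratic `K`.  For
`d_K ≢ 1 (mod 8)`: `τ_Q ↔ (4, 2b, c)`, `c` odd, `2τ_Q = τ_{d_K}`, `s₀ = s(τ_Q) ∈ H_K(j(τ_Q))`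
(unramified over `H_K` outside `2`), `j₁ s₀ = (s₀ + 16)³`, `s₀ ∣ 2¹²`; for `d_K ≡ 1 (mod 8)`:
`τ_Q` a Heegner point of level `4` in the principal class, `s₀ ∈ H_K`, `j₁ s₀² = (s₀ + 256)³`,
`s₀ ∣ 2²⁴`. [cite: Cox2013, §12.B and §11.B (11.15)] [cite: ShimuraIATAF1971, §6.8]
[cite: NeukirchANT1999, Ch. I §8 Prop. 8.2] -/
theorem three_dvd_count_span_formJ_of_two_not_mem (hK : IsImaginaryQuadratic K) (ι : K →+* ℂ)
    [NumberField (singularModuliField K ι)] (j₁ : 𝓞 (singularModuliField K ι))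
    (hj₁ : ((j₁ : singularModuliField K ι) : ℂ) = formJ (principalForm (NumberField.discr K)))
    (hj0 : j₁ ≠ 0) (v : HeightOneSpectrum (𝓞 (singularModuliField K ι)))
    (hv : ((2 : ℕ) : 𝓞 (singularModuliField K ι)) ∉ v.asIdeal) :
    3 ∣ (Associates.mk v.asIdeal).count (Associates.mk (Ideal.span {j₁})).factors := by
  set D := NumberField.discr K with hDdef
  have hD : D < 0 := hK.discr_neg
  have h4 : D % 4 = 0 ∨ D % 4 = 1 := discr_emod_four hK.1
  have hP1 : 0 < (principalForm D).1 := by rw [principalForm_fst]; exact one_pos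
  have hjint : IsIntegral ℤ (formJ (principalForm D)) :=
    isIntegral_int_formJ hP1 (isPrimitive_principalForm D) (by rw [discr_principalForm h4]; exact hD)
  -- `2¹² ∉ v`, `2²⁴ ∉ v`
  have h2pow : ∀ m : ℕ, ((2 : ℕ) : 𝓞 (singularModuliField K ι)) ^ m ∉ v.asIdeal :=
    fun m h ↦ hv (v.isPrime.mem_of_pow_mem m h)
  -- the ring map `𝓞 H_K → ℂ` is injective
  have hinjS : Function.Injective
      ((singularModuliField K ι).subtype.comp
        (algebraMap (𝓞 (singularModuliField K ι)) (singularModuliField K ι))) :=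
    Subtype.val_injective.comp RingOfIntegers.coe_injective
  by_cases h8 : D % 8 = 1
  · -- `d_K ≡ 1 (mod 8)`: a Heegner point of level `4` in the principal class
    obtain ⟨β, hβD⟩ := exists_sq_sub_dvd_sixteen h8
    obtain ⟨Q, hQ, hβ, hjQ⟩ := exists_heegnerForm_formJ_eq hK (N := 4) hβD hP1
      (isPrimitive_principalForm D) (discr_principalForm h4)
    set s₀ := deltaQuotValue (heegnerTau Q) with hs₀def
    have hs₀mem : s₀ ∈ singularModuliField K ι :=
      deltaQuotValue_heegnerTau_mem_singularModuliField hK h8 ι hβD hQ hβ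
    have hrel : formJ (principalForm D) * s₀ ^ 2 = (s₀ + 256) ^ 3 := by
      rw [← hjQ, formJ_eq_kleinJ]
      exact kleinJ_mul_deltaQuotValue_sq _
    -- integrality: `s₀³ + (768 − j) s₀² + 196608 s₀ + 2²⁴ = 0`
    have hcubic : s₀ ^ 3 + (768 - formJ (principalForm D)) * s₀ ^ 2 + 196608 * s₀ + 16777216 = 0 := by
      linear_combination -hrel
    have hs₀int : IsIntegral ℤ s₀ :=
      isIntegral_of_cubic_eq_zero (isIntegral_natCast 16777216) (isIntegral_natCast 196608)
        ((isIntegral_natCast 768).sub hjint) (by exact_mod_cast hcubic)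
    set t₀ : ℂ := -(s₀ ^ 2 + (768 - formJ (principalForm D)) * s₀ + 196608) with ht₀def
    have hst : s₀ * t₀ = 16777216 := by rw [ht₀def]; linear_combination -hcubic
    have ht₀int : IsIntegral ℤ t₀ :=
      (((hs₀int.pow 2).add (((isIntegral_natCast 768).sub hjint).mul hs₀int)).add
        (isIntegral_natCast 196608)).neg
    have ht₀mem : t₀ ∈ singularModuliField K ι := by
      rw [ht₀def]
      refine neg_mem (add_mem (add_mem (pow_mem hs₀mem 2) (mul_mem (sub_mem ?_ ?_) hs₀mem)) ?_)
      · exact_mod_cast _root_.natCast_mem (singularModuliField K ι) 768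
      · rw [← hj₁]; exact (j₁ : singularModuliField K ι).2
      · exact_mod_cast _root_.natCast_mem (singularModuliField K ι) 196608
    -- elements of `𝓞 H_K`
    have hsI : IsIntegral ℤ (⟨s₀, hs₀mem⟩ : singularModuliField K ι) :=
      (isIntegral_algHom_iff (singularModuliField K ι).subtype.toIntAlgHom Subtype.val_injective).mp hs₀int
    have htI : IsIntegral ℤ (⟨t₀, ht₀mem⟩ : singularModuliField K ι) :=
      (isIntegral_algHom_iff (singularModuliField K ι).subtype.toIntAlgHom Subtype.val_injective).mp ht₀int
    set s' : 𝓞 (singularModuliField K ι) := ⟨⟨s₀, hs₀mem⟩, hsI⟩ with hs'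
    set t' : 𝓞 (singularModuliField K ι) := ⟨⟨t₀, ht₀mem⟩, htI⟩ with ht'
    have hg : j₁ * s' ^ 2 = (s' + 256) ^ 3 := by
      apply hinjS
      simp only [RingHom.coe_comp, Function.comp_apply, map_mul, map_pow, map_add, map_ofNat]
      have h1 : (singularModuliField K ι).subtype
          (algebraMap (𝓞 (singularModuliField K ι)) (singularModuliField K ι) j₁) =
          formJ (principalForm D) := by rw [← hj₁]; rfl
      have h2 : (singularModuliField K ι).subtype
          (algebraMap (𝓞 (singularModuliField K ι)) (singularModuliField K ι) s') = s₀ := rfl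
      rw [h1, h2]
      exact hrel
    have hst' : s' * t' = ((2 : ℕ) : 𝓞 (singularModuliField K ι)) ^ 24 := by
      apply hinjS
      simp only [RingHom.coe_comp, Function.comp_apply, map_mul, map_pow, map_natCast]
      have h2 : (singularModuliField K ι).subtype
          (algebraMap (𝓞 (singularModuliField K ι)) (singularModuliField K ι) s') = s₀ := rfl
      have h3 : (singularModuliField K ι).subtype
          (algebraMap (𝓞 (singularModuliField K ι)) (singularModuliField K ι) t') = t₀ := rfl
      rw [h2, h3, hst]
      norm_num
    exact dvd_count_of_mul_pow_eq_pow_self hj0 hg hst' v (h2pow 24)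
  · -- `d_K ≢ 1 (mod 8)`: `τ_Q ↔ (4, 2b, c)`, `c` odd, `2τ_Q = τ_{(1, b, c)}`
    obtain ⟨b, c, hbc, hco⟩ : ∃ b c : ℤ, b ^ 2 - 4 * c = D ∧ Odd c := by
      rcases h4 with h40 | h41
      · by_cases h80 : D % 8 = 0
        · exact ⟨2, 1 - D / 4, by omega, ⟨-(D / 8), by omega⟩⟩
        · exact ⟨0, -(D / 4), by omega, ⟨-(D / 8) - 1, by omega⟩⟩
      · exact ⟨1, (1 - D) / 4, by omega, ⟨(1 - D) / 8, by omega⟩⟩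
    have hD' : b ^ 2 - 4 * 1 * c < 0 := by linarith
    have hdisc1 : discr ((1 : ℤ), b, c) = NumberField.discr K := by
      rw [QuadraticFields.BinaryQuadraticForm.discr_apply, ← hDdef, ← hbc]; ring
    set x := formJ ((4 * 1 : ℤ), 2 * b, c) with hxdef
    set M : IntermediateField (singularModuliField K ι) ℂ :=
      adjoin (singularModuliField K ι) ({x} : Set ℂ) with hMdef
    have h4D : 4 * (b ^ 2 - 4 * 1 * c) < 0 := by linarith
    have hprim4 : IsPrimitive ((4 * 1 : ℤ), 2 * b, c) := isPrimitive_half (isPrimitive_one b c) hco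
    have hdisc4 : discr ((4 * 1 : ℤ), 2 * b, c) = 4 * (b ^ 2 - 4 * 1 * c) := by
      rw [QuadraticFields.BinaryQuadraticForm.discr_apply]; ring
    have hA4 : 0 < ((4 * 1 : ℤ), 2 * b, c).1 := by norm_num
    have hxint : IsIntegral ℤ x := isIntegral_int_formJ hA4 hprim4 (by rw [hdisc4]; exact h4D)
    haveI : FiniteDimensional (singularModuliField K ι) M :=
      adjoin.finiteDimensional (show IsIntegral ℚ x from hxint.tower_top).tower_top
    haveI : FiniteDimensional ℚ M := Module.Finite.trans (singularModuliField K ι) M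
    haveI : NumberField M := NumberField.mk
    -- `s₀ = s(τ_Q) ∈ M`, `j₁ s₀ = (s₀ + 16)³`
    set s₀ := deltaQuotValue (heegnerTau ((4 * 1 : ℤ), 2 * b, c)) with hs₀def
    have hs₀M : s₀ ∈ M :=
      deltaQuotValue_half_mem_adjoin hK ι one_pos (isPrimitive_one b c) hdisc1 odd_one hco
    have hrel : formJ (principalForm D) * s₀ = (s₀ + 16) ^ 3 := by
      have h := kleinJ_tpD_two_mul_deltaQuotValue (heegnerTau ((4 * 1 : ℤ), 2 * b, c))
      rw [tpD_two_smul_heegnerTau one_pos hD', ← formJ_eq_kleinJ,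
        formJ_one_eq_formJ_principalForm (by linarith)] at h
      rw [show b ^ 2 - 4 * c = D from hbc] at h
      exact h
    -- integrality: `s₀³ + 48 s₀² + (768 − j) s₀ + 4096 = 0`
    have hcubic : s₀ ^ 3 + 48 * s₀ ^ 2 + (768 - formJ (principalForm D)) * s₀ + 4096 = 0 := by
      linear_combination -hrel
    have hs₀int : IsIntegral ℤ s₀ :=
      isIntegral_of_cubic_eq_zero (isIntegral_natCast 4096) ((isIntegral_natCast 768).sub hjint)
        (isIntegral_natCast 48) (by exact_mod_cast hcubic)
    set t₀ : ℂ := -(s₀ ^ 2 + 48 * s₀ + (768 - formJ (principalForm D))) with ht₀def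
    have hst : s₀ * t₀ = 4096 := by rw [ht₀def]; linear_combination -hcubic
    have ht₀int : IsIntegral ℤ t₀ :=
      (((hs₀int.pow 2).add ((isIntegral_natCast 48).mul hs₀int)).add
        ((isIntegral_natCast 768).sub hjint)).neg
    have hjM : formJ (principalForm D) ∈ M := by
      have : formJ (principalForm D) ∈ singularModuliField K ι := by
        rw [← hj₁]; exact (j₁ : singularModuliField K ι).2
      exact (algebraMap (singularModuliField K ι) M ⟨_, this⟩).2
    have ht₀M : t₀ ∈ M := by
      rw [ht₀def]
      refine neg_mem (add_mem (add_mem (pow_mem hs₀M 2) (mul_mem ?_ hs₀M)) (sub_mem ?_ hjM))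
      · exact_mod_cast _root_.natCast_mem M 48
      · exact_mod_cast _root_.natCast_mem M 768
    have hsI : IsIntegral ℤ (⟨s₀, hs₀M⟩ : M) :=
      (isIntegral_algHom_iff (M.val.restrictScalars ℤ) Subtype.val_injective).mp hs₀int
    have htI : IsIntegral ℤ (⟨t₀, ht₀M⟩ : M) :=
      (isIntegral_algHom_iff (M.val.restrictScalars ℤ) Subtype.val_injective).mp ht₀int
    set s' : 𝓞 M := ⟨⟨s₀, hs₀M⟩, hsI⟩ with hs'
    set t' : 𝓞 M := ⟨⟨t₀, ht₀M⟩, htI⟩ with ht'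
    have hinj : Function.Injective ((algebraMap M ℂ).comp (algebraMap (𝓞 M) M)) :=
      (algebraMap M ℂ).injective.comp RingOfIntegers.coe_injective
    have hg : algebraMap (𝓞 (singularModuliField K ι)) (𝓞 M) j₁ * s' ^ 1 = (s' + 16) ^ 3 := by
      apply hinj
      simp only [RingHom.coe_comp, Function.comp_apply, map_mul, map_pow, map_add, map_ofNat, pow_one]
      have h1 : algebraMap M ℂ (algebraMap (𝓞 M) M
          (algebraMap (𝓞 (singularModuliField K ι)) (𝓞 M) j₁)) =
          ((j₁ : singularModuliField K ι) : ℂ) := rfl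
      have h2 : algebraMap M ℂ (algebraMap (𝓞 M) M s') = s₀ := rfl
      rw [h1, h2, hj₁]
      exact hrel
    have hst' : s' * t' = algebraMap (𝓞 (singularModuliField K ι)) (𝓞 M)
        (((2 : ℕ) : 𝓞 (singularModuliField K ι)) ^ 12) := by
      apply hinj
      simp only [RingHom.coe_comp, Function.comp_apply, map_mul, map_pow, map_natCast]
      have h2 : algebraMap M ℂ (algebraMap (𝓞 M) M s') = s₀ := rfl
      have h3 : algebraMap M ℂ (algebraMap (𝓞 M) M t') = t₀ := rfl
      rw [h2, h3, hst]
      norm_num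
    -- `M/H_K` is unramified at `v ∌ 2`
    haveI := v.isMaximal
    have hdisc4' : discr ((4 * 1 : ℤ), 2 * b, c) = ((2 : ℕ) : ℤ) ^ 2 * NumberField.discr K := by
      rw [hdisc4, ← hDdef, ← hbc]; push_cast; ring
    have hunr : Algebra.IsUnramifiedIn (𝓞 M) v.asIdeal :=
      isUnramifiedIn_adjoin_formJ_conductor (Q := ((4 * 1 : ℤ), 2 * b, c)) hK ι (f := 2)
        (by norm_num) hA4 hprim4 hdisc4' v.asIdeal hv
    exact dvd_count_of_mul_pow_eq_pow_of_isUnramifiedIn (F := singularModuliField K ι) (L := M) hj0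
      hg hst' v (h2pow 12) hunr

end Main

end Literature.NumberTheory.EllipticCurves

end
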